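import Mathlib.LinearAlgebra.BilinearForm.Orthogonal
import Mathlib.LinearAlgebra.Span.Basic
import Mathlib.RingTheory.Finiteness.Basic
import Mathlib.GroupTheory.Index
import Literature.AlgebraicGeometry.HodgeTheory.SkewVanishingLattice
import Summits.HodgeConjecture.HodgeConjecture.Theorems.LinearSystemTorelliLocalTubeSpanAlgebra
import Summits.HodgeConjecture.HodgeConjecture.Theorems.LinearSystemTorelliLocalTubeSpanTransvections

/-!
# Route LinearSystemTorelli — crux `LocalTubeSpan`: the detecting frame of a complete cluster

Helper file (`--supports stmt-HodgeConjecture-2490`, line `Sketch`).  The theorems of the line at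
one-branch, mixed and multi-branch points of the discriminant (`…Radical`, `…Mixed`,
`…MultiCluster`) take as INPUT, for each Janssen-complete cluster of local vanishing cycles, a
linearly independent transvection frame inside the cluster's group in which every meridian of the
cluster has a positive power agreeing ON the cluster lattice `L = ℚΔ` with a frame-group element.
This file supplies that input from ORBIT DATA and the named fact `Schnell2010_lemma11` (C. Schnell,
*Primitive cohomology and the tube mapping*, Math. Z. 268 (2010) Lemma 11, from W. Janssen, Math.
Ann. 266 (1983) Thm. 2.5 / Lemma 2.7):

* `localTubeSpan_exists_frame_of_completeOrbit` — `G = ⟨s⟩` acting by transvections along a single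
  `G`-orbit `Δ` (integral, `ℤΔ` f.g., a `⟨δ₁, δ₂⟩ = 1` pair, every `T_δ` realised): a frame exists.
* `localTubeSpan_exists_frame_of_completeOrbit_closure` — the same for a cluster `s₁ ⊆ G`
  generating a SUBGROUP `⟨s₁⟩` (orbit data relative to `⟨s₁⟩`), the form consumed at mixed and
  multi-branch points.

The proof is the lattice part of `…Radical` (restriction to `L`, the degenerate vanishing lattice
`(L, Δ)`, Lemma 11, finite index ⇒ powers) made to return the frame.
-/

-- `Summit.HodgeConjecture.HodgeConjecture.Theorems` is the mandated namespace (single-conjunct summit: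
-- Sub = Summit), which `linter.dupNamespace` flags on every declaration; the lakefile turns the
-- linter off tree-wide (weak option), restated here so stand-alone elaboration is warning-free too.
set_option linter.dupNamespace false

noncomputable section

open CategoryTheory groupCohomology
open Literature.AlgebraicGeometry.HodgeTheory

namespace Summit.HodgeConjecture.HodgeConjecture.Theorems

section ClusterFrame

variable {G : Type} [Group G] (A : Rep.{0} ℚ G)

/-- **The detecting frame of a complete orbit** (from Schnell's Lemma 11).  `G = ⟨s⟩` acts on the
finite-dimensional `ℚ`-space `V = A` through transvections of an alternating `B` along members of a
single `G`-orbit `Δ` (stable, transitive, integral, `ℤΔ` finitely generated, a pair with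
`⟨δ₁, δ₂⟩ = 1`, every `T_δ` realised in `G`).  Then there are `u_i ∈ G` acting as transvections along
linearly independent `δ'_i ∈ Δ` such that every generator `t ∈ s` has a positive power agreeing on
`L = ℚΔ` with an element of `⟨u_i⟩`. [cite: Schnell2010, Lemma 11 and §7 Prop. 12 (proof)] -/
theorem localTubeSpan_exists_frame_of_completeOrbit (hL11 : Schnell2010_lemma11)
    [FiniteDimensional ℚ A.V] (B : LinearMap.BilinForm ℚ A.V) (hB : B.IsAlt) (Δ : Set A.V)
    (s : Set G) (hs : Subgroup.closure s = ⊤)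
    (hsΔ : ∀ t ∈ s, ∃ δ ∈ Δ, ∀ x : A.V, A.ρ t x = x - B x δ • δ)
    (hΔG : ∀ δ ∈ Δ, ∃ g : G, ∀ x : A.V, A.ρ g x = x - B x δ • δ)
    (hfg : (Submodule.span ℤ Δ).FG) (hint : ∀ δ ∈ Δ, ∀ δ' ∈ Δ, ∃ n : ℤ, B δ δ' = n)
    (hstable : ∀ (g : G), ∀ δ ∈ Δ, A.ρ g δ ∈ Δ)
    (htrans : ∀ δ ∈ Δ, ∀ δ' ∈ Δ, ∃ g : G, A.ρ g δ = δ')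
    (hpair : ∃ δ₁ ∈ Δ, ∃ δ₂ ∈ Δ, B δ₁ δ₂ = 1) :
    ∃ (r : ℕ) (u : Fin r → G) (δ' : Fin r → A.V), (∀ i, δ' i ∈ Δ) ∧ LinearIndependent ℚ δ' ∧
      (∀ (i : Fin r) (x : A.V), A.ρ (u i) x = x - B x (δ' i) • δ' i) ∧
      ∀ t ∈ s, ∃ m : ℕ, 0 < m ∧ ∃ γ ∈ Subgroup.closure (Set.range u),
        ∀ x ∈ Submodule.span ℚ Δ, A.ρ (t ^ m) x = A.ρ γ x := by
  classical
  -- the generators' cycles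
  choose! ecyc hecycΔ hecyc using hsΔ
  -- isometries
  have hiso : ∀ (g : G) (x y : A.V), B (A.ρ g x) (A.ρ g y) = B x y :=
    localTubeSpan_isometry_of_generators B A.ρ s hs fun t ht =>
      localTubeSpan_isometry_of_transvection_formula B hB (ecyc t) (A.ρ t) (hecyc t ht)
  -- the local lattice `L = ℚΔ` is `G`-stable; `(g - 1)V ⊆ L`
  set L : Submodule ℚ A.V := Submodule.span ℚ Δ with hLdef
  have hsubL : ∀ g : G, subOneRange A g ≤ L := fun g =>
    localTubeSpan_subOneRange_le_of_closure_eq_top A s hs L (fun t ht =>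
      (localTubeSpan_range_sub_id_le_span_of_formula B (ecyc t) (A.ρ t) (hecyc t ht)).trans
        ((Submodule.span_singleton_le_iff_mem _ _).2 (Submodule.subset_span (hecycΔ t ht)))) g
  have hLstab : ∀ (g : G), ∀ x ∈ L, A.ρ g x ∈ L := fun g x hx => by
    have h1 : A.ρ g x - x ∈ L := hsubL g ⟨x, rfl⟩
    have h2 : A.ρ g x = (A.ρ g x - x) + x := by abel
    rw [h2]
    exact L.add_mem h1 hx
  obtain ⟨δ₁, hδ₁, δ₂, hδ₂, h12⟩ := hpair
  -- the restricted representation on `L` and the restricted (degenerate) lattice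
  let resL : G →* (L →ₗ[ℚ] L) :=
    { toFun := fun g => (A.ρ g).restrict (hLstab g)
      map_one' := by
        refine LinearMap.ext fun x => Subtype.ext ?_
        simp
      map_mul' := fun g h => by
        refine LinearMap.ext fun x => Subtype.ext ?_
        simp }
  have hresL : ∀ (g : G) (x : L), ((resL g x : L) : A.V) = A.ρ g x := fun g x => rfl
  let B' : LinearMap.BilinForm ℚ L := B.restrict L
  have hB'ap : ∀ x y : L, B' x y = B x y := fun x y => rfl
  have hB' : B'.IsAlt := fun x => hB (x : A.V)
  let Δ' : Set L := {x : L | (x : A.V) ∈ Δ}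
  -- a transvection of `V` along `δ ∈ L` restricts to the transvection of `L`
  have hrestrT : ∀ (g : G) (δ : L), (∀ x : A.V, A.ρ g x = x - B x δ • (δ : A.V)) →
      resL g = skewTransvection B' δ := fun g δ hg => by
    refine LinearMap.ext fun x => Subtype.ext ?_
    rw [hresL, hg, skewTransvection_apply, Submodule.coe_sub, Submodule.coe_smul, hB'ap]
  have hsT' : ∀ t ∈ s, ∃ δ ∈ Δ', resL t = skewTransvection B' δ := fun t ht =>
    ⟨⟨ecyc t, Submodule.subset_span (hecycΔ t ht)⟩, hecycΔ t ht,
      hrestrT t ⟨ecyc t, _⟩ (hecyc t ht)⟩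
  have hreal' : ∀ δ ∈ Δ', ∃ g : G, resL g = skewTransvection B' δ := fun δ hδ => by
    obtain ⟨g, hg⟩ := hΔG (δ : A.V) hδ
    exact ⟨g, hrestrT g δ hg⟩
  -- `Δ'` is a skew vanishing lattice in `L`
  have hΔ' : IsSkewVanishingLattice B' Δ' := by
    refine ⟨?_, ?_, ?_, ?_, ?_, ?_⟩
    · -- `ℤΔ'` is finitely generated: its image under the injective `L → V` is `ℤΔ`
      let ι : L →ₗ[ℤ] A.V := L.subtype.restrictScalars ℤ
      refine Submodule.fg_of_fg_map_injective ι (fun x y h => Subtype.ext h) ?_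
      have himg : (ι : L → A.V) '' Δ' = Δ := by
        ext v
        constructor
        · rintro ⟨x, hx, rfl⟩; exact hx
        · intro hv; exact ⟨⟨v, Submodule.subset_span hv⟩, hv, rfl⟩
      rw [Submodule.map_span, himg]
      exact hfg
    · intro δ hδ δ' hδ'
      exact hint _ hδ _ hδ'
    · -- `Δ'` spans `L`
      exact Submodule.span_span_coe_preimage
    · -- stable
      intro γ hγ δ hδ
      obtain ⟨g, hg⟩ :=
        localTubeSpan_exists_toHomUnits_eq_of_mem_transvectionGroup B' Δ' resL s hs hsT' hreal' hγ
      change ((γ : L →ₗ[ℚ] L) δ : A.V) ∈ Δ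
      rw [← hg, hresL]
      exact hstable g _ hδ
    · -- transitive
      intro δ hδ δ' hδ'
      obtain ⟨g, hg⟩ := htrans _ hδ _ hδ'
      refine ⟨resL.toHomUnits g,
        localTubeSpan_toHomUnits_mem_transvectionGroup B' Δ' resL s hs hsT' hreal' g, ?_⟩
      exact Subtype.ext (by rw [MonoidHom.coe_toHomUnits, hresL, hg])
    · exact ⟨⟨δ₁, Submodule.subset_span hδ₁⟩, hδ₁, ⟨δ₂, Submodule.subset_span hδ₂⟩, hδ₂, h12⟩
  -- Lemma 11: a linearly independent frame in `Δ'` whose transvections have finite index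
  obtain ⟨r, δ', -, hδ'Δ, hli, hfi⟩ := hL11 L B' hB' Δ' hΔ'
  -- the frame upstairs
  let δfr : Fin r → A.V := fun i => (δ' i : A.V)
  have hδfr : LinearIndependent ℚ δfr := hli.map' L.subtype (Submodule.ker_subtype L)
  have hδfrΔ : ∀ i, δfr i ∈ Δ := fun i => hδ'Δ i
  choose u hu using fun i => hΔG (δfr i) (hδfrΔ i)
  -- the frame group upstairs maps onto the frame group of `L`
  have hframe : transvectionGroup B' (Set.range δ') ≤
      (Subgroup.closure (Set.range u)).map resL.toHomUnits := by
    unfold transvectionGroup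
    refine (Subgroup.closure_le _).2 ?_
    rintro w ⟨_, ⟨i, rfl⟩, hw⟩
    refine ⟨u i, Subgroup.subset_closure ⟨i, rfl⟩, Units.ext ?_⟩
    rw [MonoidHom.coe_toHomUnits, hw]
    exact hrestrT (u i) (δ' i) (hu i)
  -- finite index downstairs ⇒ every generator has a power agreeing on `L` with a frame element
  refine ⟨r, u, δfr, hδfrΔ, hδfr, hu, fun t ht => ?_⟩
  have htmem : resL.toHomUnits t ∈ transvectionGroup B' Δ' :=
    localTubeSpan_toHomUnits_mem_transvectionGroup B' Δ' resL s hs hsT' hreal' t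
  haveI := hfi
  obtain ⟨m, hmpos, -, hm⟩ := Subgroup.exists_pow_mem_of_index_ne_zero
    (Subgroup.FiniteIndex.index_ne_zero
      (H := (transvectionGroup B' (Set.range δ')).subgroupOf (transvectionGroup B' Δ')))
    (⟨resL.toHomUnits t, htmem⟩ : transvectionGroup B' Δ')
  rw [Subgroup.mem_subgroupOf, SubgroupClass.coe_pow, ← map_pow] at hm
  obtain ⟨γ, hγ, hγeq⟩ := hframe hm
  refine ⟨m, hmpos, γ, hγ, fun x hx => ?_⟩
  have h2 := congrArg (fun w : (L →ₗ[ℚ] L)ˣ => (((w : L →ₗ[ℚ] L) ⟨x, hx⟩ : L) : A.V)) hγeq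
  simpa only [MonoidHom.coe_toHomUnits, hresL] using h2.symm

/-- **The detecting frame of a complete cluster inside a bigger group** (orbit data relative to the
subgroup `⟨s₁⟩`; from `localTubeSpan_exists_frame_of_completeOrbit` applied to the restriction of
the representation to `⟨s₁⟩`).  This is the frame input of the theorems at mixed and multi-branch
points. [cite: Schnell2010, Lemma 11 and §7 Prop. 12 (proof)] -/
theorem localTubeSpan_exists_frame_of_completeOrbit_closure (hL11 : Schnell2010_lemma11)
    [FiniteDimensional ℚ A.V] (B : LinearMap.BilinForm ℚ A.V) (hB : B.IsAlt) (Δ : Set A.V)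
    (s₁ : Set G)
    (hsΔ : ∀ t ∈ s₁, ∃ δ ∈ Δ, ∀ x : A.V, A.ρ t x = x - B x δ • δ)
    (hΔG : ∀ δ ∈ Δ, ∃ g ∈ Subgroup.closure s₁, ∀ x : A.V, A.ρ g x = x - B x δ • δ)
    (hfg : (Submodule.span ℤ Δ).FG) (hint : ∀ δ ∈ Δ, ∀ δ' ∈ Δ, ∃ n : ℤ, B δ δ' = n)
    (hstable : ∀ g ∈ Subgroup.closure s₁, ∀ δ ∈ Δ, A.ρ g δ ∈ Δ)
    (htrans : ∀ δ ∈ Δ, ∀ δ' ∈ Δ, ∃ g ∈ Subgroup.closure s₁, A.ρ g δ = δ')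
    (hpair : ∃ δ₁ ∈ Δ, ∃ δ₂ ∈ Δ, B δ₁ δ₂ = 1) :
    ∃ (r : ℕ) (u : Fin r → G) (δ' : Fin r → A.V), (∀ i, u i ∈ Subgroup.closure s₁) ∧
      (∀ i, δ' i ∈ Δ) ∧ LinearIndependent ℚ δ' ∧
      (∀ (i : Fin r) (x : A.V), A.ρ (u i) x = x - B x (δ' i) • δ' i) ∧
      ∀ t ∈ s₁, ∃ m : ℕ, 0 < m ∧ ∃ γ ∈ Subgroup.closure (Set.range u),
        ∀ x ∈ Submodule.span ℚ Δ, A.ρ (t ^ m) x = A.ρ γ x := by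
  set H : Subgroup G := Subgroup.closure s₁ with hH
  let A₁ : Rep.{0} ℚ H := Rep.res H.subtype A
  let s' : Set H := ((↑) : H → G) ⁻¹' s₁
  have hs' : Subgroup.closure s' = ⊤ := Subgroup.closure_closure_coe_preimage
  have hρ : ∀ (h : H) (x : A.V), A₁.ρ h x = A.ρ (h : G) x := fun h x => by
    rw [Rep.coe_res_obj_ρ']
    rfl
  obtain ⟨r, u', δ', hδ'Δ, hli, hu', hvirt'⟩ :=
    localTubeSpan_exists_frame_of_completeOrbit A₁ hL11 B hB Δ s' hs'
      (fun t ht => by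
        obtain ⟨δ, hδ, h⟩ := hsΔ (t : G) ht
        exact ⟨δ, hδ, fun x => by rw [hρ]; exact h x⟩)
      (fun δ hδ => by
        obtain ⟨g, hg, h⟩ := hΔG δ hδ
        exact ⟨⟨g, hg⟩, fun x => by rw [hρ]; exact h x⟩)
      hfg hint
      (fun g δ hδ => by rw [hρ]; exact hstable _ g.2 δ hδ)
      (fun δ hδ δ'' hδ'' => by
        obtain ⟨g, hg, h⟩ := htrans δ hδ δ'' hδ''
        exact ⟨⟨g, hg⟩, by rw [hρ]; exact h⟩)
      hpair
  refine ⟨r, fun i => (u' i : G), δ', fun i => (u' i).2, hδ'Δ, hli,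
    fun i x => by rw [← hρ]; exact hu' i x, fun t ht => ?_⟩
  obtain ⟨m, hmpos, γ', hγ', hγ'L⟩ := hvirt' ⟨t, Subgroup.subset_closure ht⟩ ht
  refine ⟨m, hmpos, (γ' : G), ?_, fun x hx => ?_⟩
  · -- the image of `⟨u'⟩ ≤ H` under the inclusion is `⟨u⟩`
    have hmap : (Subgroup.closure (Set.range u')).map H.subtype =
        Subgroup.closure (Set.range fun i => (u' i : G)) := by
      rw [MonoidHom.map_closure]
      congr 1
      ext g
      simp only [Set.mem_image, Set.mem_range, Subgroup.coe_subtype]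
      constructor
      · rintro ⟨_, ⟨i, rfl⟩, rfl⟩; exact ⟨i, rfl⟩
      · rintro ⟨i, rfl⟩; exact ⟨_, ⟨i, rfl⟩, rfl⟩
    rw [← hmap]
    exact ⟨γ', hγ', rfl⟩
  · have := hγ'L x hx
    rwa [hρ, hρ, Subgroup.coe_pow] at this

end ClusterFrame

end Summit.HodgeConjecture.HodgeConjecture.Theorems

end
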